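import Mathlib
import HarnessLib
import Summits.NavierStokesRegularity.NavierStokesRegularity.Theorems.TaylorModelRungThreeCertificateReadoutsEnclosure

/-!
# Crux K1b-DR (stmt-NavierStokesRegularity-23954), line `taylor-model` — certificate SOUNDNESS for the `Readouts`
# block, part 3: the E1 read-outs at the crossing states and the base-landing clause

From `checkRO_crossing = true` (with `checkReadoutAux`, and `0 ≤ NDL` from `checkRO_scalars`): the conjunct of
`CertData.Readouts (toCertData φ T)` at the crossing states `y = TP u + w'` of the last sub-step — `as ≤ |y_{i₀,1}|`, the
behind-shell clause against `2^(-θ)·Cb·2^(3(Kb+1)/4)`, and the landing-derivative bound `|ℓ (nx j) l (landD y v z)| ≤ NDL`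
via the pointwise majorant `abs_wv_landD_le`. From `checkRO_land = true`: the base-landing polytope conjunct via the
pointwise enclosure `abs_wv_land_sub_mid_le` (interval quotient, extrema at the corners). The section equation
`σf y = lev` is not used (sound: it only shrinks the set of states).

MODEL-lattice rung TL-M3 only; nothing here is a statement about the Navier–Stokes equations.
-/

-- the sub-problem namespace repeats the summit name by design (D-0017)
set_option linter.dupNamespace false

namespace Summit.NavierStokesRegularity.NavierStokesRegularity.Theorems.TaylorModelCert

open scoped BigOperators
open Literature.Analysis.FluidPDE.TaoCascade Literature.Analysis.FluidPDE.TaoCascade.TaylorChain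

namespace CertTables

/-! ### CROSSING READ-OUTS (`as`, behind-shell, landing derivative) -/

section Crossing

variable {K : Type} [Field K] [LinearOrder K] {φ : K →+* ℝ} (hφ : Monotone φ) (T : CertTables K)
  (A : ReadoutAux K)
include hφ

/-- Pointwise majorant of the landing derivative at the crossing states:
`|landD y v z|_c ≤ |φ Lv(nx j)| · φ (landDMaj_c)`. [folklore] -/
theorem abs_wv_landD_le (haux : T.checkReadoutAux A = true) (j s : ℕ) (h sp : K) {u : ℝ}
    (hu : u ∈ Set.Icc 0 (φ h)) {w' : Fin 4 → ℤ → ℝ} (hw : (T.toCertData φ).InBall j w' (φ sp))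
    (ha : 0 < T.aLo j (T.node j s) h sp) (v : Fin 4 → ℝ)
    (hv : ∀ i, |v i| ≤ Real.sqrt (10 * φ T.Cg * (2:ℝ) ^ (-(7:ℝ) * ((T.Ka:ℝ) + 1))))
    (z : Fin 4 → ℤ → ℝ) (hz : (T.toCertData φ).InBall j z 1) {c : ℕ} (hc : c < T.n) :
    |T.wv ((T.toCertData φ).landD j ((T.toCertData φ).TP j s u + w') v z) c| ≤
      |φ (T.stage (T.stage j).nx).Lv| * φ (T.landDMaj A j (T.node j s) h sp (T.aLo j (T.node j s) h sp) c) := by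
  obtain ⟨hKb, hKa, -, -, -, -, -, htv⟩ := T.aux_sound hφ A haux
  have hW1 : -T.Kb ≤ (1:ℤ) ∧ (1:ℤ) ≤ T.Ka := ⟨by omega, hKa⟩
  have hc1 : T.idx T.i₀ 1 < T.n := T.idx_lt_n T.i₀ hW1
  set y := (T.toCertData φ).TP j s u + w' with hy
  -- the denominator
  have hD : y T.i₀ 1 = T.wv y (T.idx T.i₀ 1) := (T.wv_idx y T.i₀ hW1).symm
  have haD : φ (T.aLo j (T.node j s) h sp) ≤ |y T.i₀ 1| := by rw [hD]; exact T.aLo_le_abs_wv hφ j s h sp hu hw hc1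
  have ha' : 0 < φ (T.aLo j (T.node j s) h sp) := phi_pos hφ ha
  have hDpos : 0 < |y T.i₀ 1| := lt_of_lt_of_le ha' haD
  have hD2 : φ (T.aLo j (T.node j s) h sp) ^ 2 ≤ y T.i₀ 1 ^ 2 := by
    rw [← sq_abs (y T.i₀ 1)]; exact pow_le_pow_left₀ ha'.le haD 2
  have hz1 : |z T.i₀ 1| ≤ φ (T.wgt j (T.idx T.i₀ 1)) := by
    have := hz T.i₀ 1 hW1.1 hW1.2
    rwa [one_mul, T.omega_of_InW φ j T.i₀ hW1] at this
  have hkW := T.InW_wk hc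
  -- unfold the derivative at the coordinate `c = (wi c, wk c)`
  have e0 : T.wv ((T.toCertData φ).landD j y v z) c =
      φ (T.stage (T.stage j).nx).Lv * ((if T.wk c + 1 ≤ T.Ka then z (T.wi c) (1 + T.wk c) else 0) / |y T.i₀ 1| -
        (if T.wk c + 1 ≤ T.Ka then y (T.wi c) (1 + T.wk c) else v (T.wi c)) *
          (Real.sign (y T.i₀ 1) * z T.i₀ 1) / y T.i₀ 1 ^ 2) := rfl
  rw [e0, abs_mul]
  refine mul_le_mul_of_nonneg_left ?_ (abs_nonneg _)
  have hsg : |Real.sign (y T.i₀ 1)| ≤ 1 := by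
    rcases Real.sign_apply_eq (y T.i₀ 1) with h' | h' | h' <;> rw [h'] <;> norm_num
  by_cases hk : T.wk c + 1 ≤ T.Ka
  · have hup : T.upInW c = true := (T.upInW_iff c hW1).2 hk
    have hkW' : -T.Kb ≤ T.wk c + 1 ∧ T.wk c + 1 ≤ T.Ka := ⟨by omega, hk⟩
    have hidx : T.idx (T.wi c) (T.wk c + 1) = c + 1 := by rw [T.idx_succ (T.wi c) hkW.1, T.idx_wi_wk hc]
    have hc' : c + 1 < T.n := by rw [← hidx]; exact T.idx_lt_n (T.wi c) hkW'
    have hwv : T.wv y (c + 1) = y (T.wi c) (T.wk c + 1) := by rw [← hidx, T.wv_idx y (T.wi c) hkW']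
    have hzup : |z (T.wi c) (T.wk c + 1)| ≤ φ (T.wgt j (c + 1)) := by
      have := hz (T.wi c) (T.wk c + 1) hkW'.1 hkW'.2
      rwa [one_mul, T.omega_of_InW φ j (T.wi c) hkW', hidx] at this
    have hyup : |y (T.wi c) (T.wk c + 1)| ≤ φ (T.yAbs j (T.node j s) h sp (c + 1)) := by
      have := T.abs_wv_le_yAbs hφ j s h sp hu hw hc'
      rwa [hwv] at this
    rw [add_comm (1:ℤ) (T.wk c), if_pos hk, if_pos hk]
    unfold landDMaj
    rw [if_pos hup, map_add, map_div₀, map_div₀, map_mul, map_pow]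
    refine (abs_sub _ _).trans (add_le_add ?_ ?_)
    · rw [abs_div, abs_abs]
      exact div_le_div₀ ((abs_nonneg _).trans hzup) hzup ha' haD
    · rw [abs_div, abs_mul, abs_mul, abs_pow, sq_abs]
      have hnum : |y (T.wi c) (T.wk c + 1)| * (|Real.sign (y T.i₀ 1)| * |z T.i₀ 1|) ≤
          φ (T.yAbs j (T.node j s) h sp (c + 1)) * φ (T.wgt j (T.idx T.i₀ 1)) := by
        have h1 : |Real.sign (y T.i₀ 1)| * |z T.i₀ 1| ≤ φ (T.wgt j (T.idx T.i₀ 1)) := by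
          calc |Real.sign (y T.i₀ 1)| * |z T.i₀ 1| ≤ 1 * |z T.i₀ 1| :=
                mul_le_mul_of_nonneg_right hsg (abs_nonneg _)
            _ ≤ φ (T.wgt j (T.idx T.i₀ 1)) := by rw [one_mul]; exact hz1
        exact mul_le_mul hyup h1 (by positivity) ((abs_nonneg _).trans hyup)
      exact div_le_div₀ (mul_nonneg ((abs_nonneg _).trans hyup) ((abs_nonneg _).trans hz1)) hnum (pow_pos ha' 2) hD2
  · have hup : ¬ (T.upInW c = true) := fun h' => hk ((T.upInW_iff c hW1).1 h')
    rw [if_neg hk, if_neg hk, zero_div, zero_sub, abs_neg]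
    unfold landDMaj
    rw [if_neg hup, map_div₀, map_mul, map_pow]
    rw [abs_div, abs_mul, abs_mul, abs_pow, sq_abs]
    have hvi : |v (T.wi c)| ≤ φ A.tv := (hv (T.wi c)).trans htv
    have hnum : |v (T.wi c)| * (|Real.sign (y T.i₀ 1)| * |z T.i₀ 1|) ≤ φ A.tv * φ (T.wgt j (T.idx T.i₀ 1)) := by
      have h1 : |Real.sign (y T.i₀ 1)| * |z T.i₀ 1| ≤ φ (T.wgt j (T.idx T.i₀ 1)) := by
        calc |Real.sign (y T.i₀ 1)| * |z T.i₀ 1| ≤ 1 * |z T.i₀ 1| :=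
              mul_le_mul_of_nonneg_right hsg (abs_nonneg _)
          _ ≤ φ (T.wgt j (T.idx T.i₀ 1)) := by rw [one_mul]; exact hz1
      exact mul_le_mul hvi h1 (by positivity) ((abs_nonneg _).trans hvi)
    exact div_le_div₀ (mul_nonneg ((abs_nonneg _).trans hvi) ((abs_nonneg _).trans hz1)) hnum (pow_pos ha' 2) hD2

/-- Soundness of `checkRO_crossing` (with `checkReadoutAux` and the `NDL ≥ 0` part of `checkRO_scalars`): the E1
read-outs of `Readouts` at the crossing states of the last sub-step. [folklore] -/
theorem ro_crossing (haux : T.checkReadoutAux A = true) (j : ℕ) (h : T.checkRO_crossing A j = true)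
    (hs : T.checkRO_scalars j = true) :
    ∀ u ∈ Set.Icc 0 ((T.toCertData φ).h j ((T.toCertData φ).S j - 1)), ∀ w' : Fin 4 → ℤ → ℝ,
      (T.toCertData φ).InBall j w' ((T.toCertData φ).Sp j ((T.toCertData φ).S j - 1)) →
      (T.toCertData φ).σf j ((T.toCertData φ).TP j ((T.toCertData φ).S j - 1) u + w') = (T.toCertData φ).lev j →
      (T.toCertData φ).as j ≤ |((T.toCertData φ).TP j ((T.toCertData φ).S j - 1) u + w') (T.toCertData φ).i₀ 1| ∧
      (∀ i, |((T.toCertData φ).TP j ((T.toCertData φ).S j - 1) u + w') i (-(T.toCertData φ).Kb)| +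
          (T.toCertData φ).Λ j * (T.toCertData φ).δ j * (T.toCertData φ).τs * (T.toCertData φ).ω j (-(T.toCertData φ).Kb) ≤
        (2:ℝ) ^ (-(T.toCertData φ).θ) * ((T.toCertData φ).Cb * (2:ℝ) ^ ((3:ℝ) / 4 * (((T.toCertData φ).Kb:ℝ) + 1)))) ∧
      (∀ (v : Fin 4 → ℝ) (l : ℕ), (∀ i, |v i| ≤ Real.sqrt (10 * (T.toCertData φ).Cg * (2:ℝ) ^ (-(7:ℝ) * (((T.toCertData φ).Ka:ℝ) + 1)))) →
        ∀ z : Fin 4 → ℤ → ℝ, (T.toCertData φ).InBall j z 1 →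
          |(T.toCertData φ).ℓ ((T.toCertData φ).nx j) l ((T.toCertData φ).landD j ((T.toCertData φ).TP j ((T.toCertData φ).S j - 1) u + w') v z)| ≤
            (T.toCertData φ).NDL j l) := by
  have hndl := T.ro_ndl hφ j hs
  obtain ⟨hKb, hKa, hCb, hp0, hp, hr0, hr, htv⟩ := T.aux_sound hφ A haux
  simp only [checkRO_crossing, allN_eq_true, Bool.and_eq_true, decide_eq_true_eq] at h
  obtain ⟨⟨⟨has, hbeh⟩, ha⟩, hlD⟩ := h
  have hW1 : -T.Kb ≤ (1:ℤ) ∧ (1:ℤ) ≤ T.Ka := ⟨by omega, hKa⟩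
  have hWb : -T.Kb ≤ -T.Kb ∧ -T.Kb ≤ T.Ka := ⟨le_refl _, by omega⟩
  have hc1 : T.idx T.i₀ 1 < T.n := T.idx_lt_n T.i₀ hW1
  intro u hu w' hw _
  change u ∈ Set.Icc 0 (φ (T.step j ((T.stage j).S - 1)).h) at hu
  change (T.toCertData φ).InBall j w' (φ (T.step j ((T.stage j).S - 1)).Sp) at hw
  set s := (T.stage j).S - 1 with hsdef
  set y := (T.toCertData φ).TP j s u + w' with hy
  refine ⟨?_, fun i => ?_, fun v l hv z hz => ?_⟩
  · -- front amplitude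
    show φ (T.stage j).as ≤ |y T.i₀ 1|
    rw [← T.wv_idx y T.i₀ hW1]
    exact (hφ has).trans (T.aLo_le_abs_wv hφ j s _ _ hu hw hc1)
  · -- behind shell
    have hci : T.idx i (-T.Kb) < T.n := T.idx_lt_n i hWb
    have e1 : y i (-T.Kb) = T.wv y (T.idx i (-T.Kb)) := (T.wv_idx y i hWb).symm
    show |y i (-T.Kb)| + φ (T.stage j).Λ * φ (T.stage j).δ * φ T.τs * (T.toCertData φ).ω j (-T.Kb) ≤
      (2:ℝ) ^ (-(φ T.θ)) * (φ T.Cb * (2:ℝ) ^ ((3:ℝ) / 4 * ((T.Kb:ℝ) + 1)))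
    rw [T.omega_of_InW φ j i hWb, e1]
    have h1 := T.abs_wv_le_yAbs hφ j s _ _ hu hw hci
    have h2 := hφ (hbeh i.val i.isLt)
    rw [T.idx_negKb i] at h1 ⊢
    simp only [map_add, map_mul] at h2
    refine le_trans (by linarith [h1, h2]) (le_trans (le_refl (φ A.pθ * φ T.Cb * φ A.r34)) ?_)
    rw [mul_assoc]
    exact mul_le_mul hp (mul_le_mul_of_nonneg_left hr hCb) (mul_nonneg hCb hr0) (by positivity)
  · -- landing derivative
    by_cases hl : l < (T.stage (T.stage j).nx).ell.length
    · have hchk := hφ (hlD l hl)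
      rw [map_mul, phi_abs hφ, phi_sumN] at hchk
      show |T.covR φ ((T.stage (T.stage j).nx).ell.getD l []) ((T.toCertData φ).landD j y v z)| ≤ φ (vget (T.stage j).NDL l)
      refine le_trans (T.abs_covR_le φ _ _ _ fun c hc => T.abs_wv_landD_le hφ A haux j s _ _ hu hw ha v hv z hz hc) ?_
      refine le_trans (le_of_eq ?_) hchk
      rw [Finset.mul_sum]
      refine Finset.sum_congr rfl fun c _ => ?_
      rw [map_mul, phi_abs hφ]; ring
    · rw [not_lt] at hl
      have e : (T.stage (T.stage j).nx).ell.getD l [] = [] := List.getD_eq_default _ _ hl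
      show |T.covR φ ((T.stage (T.stage j).nx).ell.getD l []) ((T.toCertData φ).landD j y v z)| ≤ (T.toCertData φ).NDL j l
      rw [e, T.covR_nil φ, abs_zero]
      exact (hndl l).1

end Crossing

/-! ### BASE LANDING into the successor polytope -/

section Landing

variable {K : Type} [Field K] [LinearOrder K] {φ : K →+* ℝ} (hφ : Monotone φ) (T : CertTables K)
  (A : ReadoutAux K)
include hφ

/-- Pointwise enclosure of the landing map at the crossing states:
`|land y v|_c − φ landMid_c| ≤ φ landRadius_c`. [folklore] -/
theorem abs_wv_land_sub_mid_le (haux : T.checkReadoutAux A = true) (j s : ℕ) (h sp : K) {u : ℝ}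
    (hu : u ∈ Set.Icc 0 (φ h)) {w' : Fin 4 → ℤ → ℝ} (hw : (T.toCertData φ).InBall j w' (φ sp))
    (ha : 0 < T.aLo j (T.node j s) h sp) (hLv : 0 ≤ (T.stage (T.stage j).nx).Lv) (v : Fin 4 → ℝ)
    (hv : ∀ i, |v i| ≤ Real.sqrt (10 * φ T.Cg * (2:ℝ) ^ (-(7:ℝ) * ((T.Ka:ℝ) + 1)))) {c : ℕ} (hc : c < T.n) :
    |T.wv ((T.toCertData φ).land j ((T.toCertData φ).TP j s u + w') v) c -
        φ (T.landMid A j (T.node j s) h sp (T.stage (T.stage j).nx).Lv c)| ≤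
      φ (T.landRadius A j (T.node j s) h sp (T.stage (T.stage j).nx).Lv c) := by
  obtain ⟨hKb, hKa, -, -, -, -, -, htv⟩ := T.aux_sound hφ A haux
  have hW1 : -T.Kb ≤ (1:ℤ) ∧ (1:ℤ) ≤ T.Ka := ⟨by omega, hKa⟩
  have hc1 : T.idx T.i₀ 1 < T.n := T.idx_lt_n T.i₀ hW1
  set y := (T.toCertData φ).TP j s u + w' with hy
  have hD : y T.i₀ 1 = T.wv y (T.idx T.i₀ 1) := (T.wv_idx y T.i₀ hW1).symm
  have ha' : 0 < φ (T.aLo j (T.node j s) h sp) := phi_pos hφ ha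
  have hDlo : φ (T.aLo j (T.node j s) h sp) ≤ |y T.i₀ 1| := by
    rw [hD]; exact T.aLo_le_abs_wv hφ j s h sp hu hw hc1
  have hDhi : |y T.i₀ 1| ≤ φ (T.yAbs j (T.node j s) h sp (T.idx T.i₀ 1)) := by
    rw [hD]; exact T.abs_wv_le_yAbs hφ j s h sp hu hw hc1
  have hkW := T.InW_wk hc
  -- the numerator and its enclosure
  have hY : φ (T.numLo A j (T.node j s) h sp c) ≤ (if T.wk c + 1 ≤ T.Ka then y (T.wi c) (1 + T.wk c) else v (T.wi c)) ∧
      (if T.wk c + 1 ≤ T.Ka then y (T.wi c) (1 + T.wk c) else v (T.wi c)) ≤ φ (T.numHi A j (T.node j s) h sp c) := by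
    unfold numLo numHi
    by_cases hk : T.wk c + 1 ≤ T.Ka
    · have hup : T.upInW c = true := (T.upInW_iff c hW1).2 hk
      have hkW' : -T.Kb ≤ T.wk c + 1 ∧ T.wk c + 1 ≤ T.Ka := ⟨by omega, hk⟩
      have hidx : T.idx (T.wi c) (T.wk c + 1) = c + 1 := by rw [T.idx_succ (T.wi c) hkW.1, T.idx_wi_wk hc]
      have hc' : c + 1 < T.n := by rw [← hidx]; exact T.idx_lt_n (T.wi c) hkW'
      have hh := T.wv_mem_yLo_yHi hφ j s h sp hu hw hc'
      have hwv : T.wv y (c + 1) = y (T.wi c) (1 + T.wk c) := by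
        rw [← hidx, T.wv_idx y (T.wi c) hkW', add_comm (T.wk c) 1]
      rw [hwv] at hh
      rw [if_pos hk, if_pos hup, if_pos hup]
      exact hh
    · have hup : ¬ (T.upInW c = true) := fun h' => hk ((T.upInW_iff c hW1).1 h')
      rw [if_neg hk, if_neg hup, if_neg hup, map_neg]
      have hvi : |v (T.wi c)| ≤ φ A.tv := (hv (T.wi c)).trans htv
      rw [abs_le] at hvi
      exact hvi
  have hq := quot_mem hY ha' ⟨hDlo, hDhi⟩
  -- the value
  have e0 : T.wv ((T.toCertData φ).land j y v) c =
      φ (T.stage (T.stage j).nx).Lv * (if T.wk c + 1 ≤ T.Ka then y (T.wi c) (1 + T.wk c) else v (T.wi c)) / |y T.i₀ 1| := rfl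
  rw [e0, mul_div_assoc]
  have eqlo : φ (quotLo (T.numLo A j (T.node j s) h sp c) (T.aLo j (T.node j s) h sp)
      (T.yAbs j (T.node j s) h sp (T.idx T.i₀ 1))) =
      min (φ (T.numLo A j (T.node j s) h sp c) / φ (T.aLo j (T.node j s) h sp))
        (φ (T.numLo A j (T.node j s) h sp c) / φ (T.yAbs j (T.node j s) h sp (T.idx T.i₀ 1))) := by
    unfold quotLo; rw [phi_min hφ, map_div₀, map_div₀]
  have eqhi : φ (quotHi (T.numHi A j (T.node j s) h sp c) (T.aLo j (T.node j s) h sp)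
      (T.yAbs j (T.node j s) h sp (T.idx T.i₀ 1))) =
      max (φ (T.numHi A j (T.node j s) h sp c) / φ (T.aLo j (T.node j s) h sp))
        (φ (T.numHi A j (T.node j s) h sp c) / φ (T.yAbs j (T.node j s) h sp (T.idx T.i₀ 1))) := by
    unfold quotHi; rw [phi_max hφ, map_div₀, map_div₀]
  have emid : φ (T.landMid A j (T.node j s) h sp (T.stage (T.stage j).nx).Lv c) =
      φ (T.stage (T.stage j).nx).Lv * ((φ (quotLo (T.numLo A j (T.node j s) h sp c) (T.aLo j (T.node j s) h sp)
        (T.yAbs j (T.node j s) h sp (T.idx T.i₀ 1))) + φ (quotHi (T.numHi A j (T.node j s) h sp c)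
        (T.aLo j (T.node j s) h sp) (T.yAbs j (T.node j s) h sp (T.idx T.i₀ 1)))) / 2) := by
    unfold landMid; rw [map_mul, map_div₀, map_add, map_ofNat]
  have erad : φ (T.landRadius A j (T.node j s) h sp (T.stage (T.stage j).nx).Lv c) =
      φ (T.stage (T.stage j).nx).Lv * ((φ (quotHi (T.numHi A j (T.node j s) h sp c) (T.aLo j (T.node j s) h sp)
        (T.yAbs j (T.node j s) h sp (T.idx T.i₀ 1))) - φ (quotLo (T.numLo A j (T.node j s) h sp c)
        (T.aLo j (T.node j s) h sp) (T.yAbs j (T.node j s) h sp (T.idx T.i₀ 1)))) / 2) := by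
    unfold landRadius; rw [map_mul, map_div₀, map_sub, map_ofNat]
  rw [emid, erad, eqlo, eqhi]
  set qlo := min (φ (T.numLo A j (T.node j s) h sp c) / φ (T.aLo j (T.node j s) h sp))
    (φ (T.numLo A j (T.node j s) h sp c) / φ (T.yAbs j (T.node j s) h sp (T.idx T.i₀ 1)))
  set qhi := max (φ (T.numHi A j (T.node j s) h sp c) / φ (T.aLo j (T.node j s) h sp))
    (φ (T.numHi A j (T.node j s) h sp c) / φ (T.yAbs j (T.node j s) h sp (T.idx T.i₀ 1)))
  set t := (if T.wk c + 1 ≤ T.Ka then y (T.wi c) (1 + T.wk c) else v (T.wi c)) / |y T.i₀ 1|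
  have hL := phi_nonneg hφ hLv
  have h1 : φ (T.stage (T.stage j).nx).Lv * qlo ≤ φ (T.stage (T.stage j).nx).Lv * t :=
    mul_le_mul_of_nonneg_left hq.1 hL
  have h2 : φ (T.stage (T.stage j).nx).Lv * t ≤ φ (T.stage (T.stage j).nx).Lv * qhi :=
    mul_le_mul_of_nonneg_left hq.2 hL
  rw [abs_le]
  constructor <;> nlinarith [h1, h2]

/-- Soundness of `checkRO_land` (with `checkReadoutAux`): the base-landing polytope clause of `Readouts`. [folklore] -/
theorem ro_land (haux : T.checkReadoutAux A = true) (j : ℕ) (h : T.checkRO_land A j = true) :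
    ∀ u ∈ Set.Icc 0 ((T.toCertData φ).h j ((T.toCertData φ).S j - 1)), ∀ w' : Fin 4 → ℤ → ℝ,
      (T.toCertData φ).InBall j w' ((T.toCertData φ).SpI j ((T.toCertData φ).S j - 1)) →
      (T.toCertData φ).σf j ((T.toCertData φ).TP j ((T.toCertData φ).S j - 1) u + w') = (T.toCertData φ).lev j →
      ∀ (v : Fin 4 → ℝ), (∀ i, |v i| ≤ Real.sqrt (10 * (T.toCertData φ).Cg * (2:ℝ) ^ (-(7:ℝ) * (((T.toCertData φ).Ka:ℝ) + 1)))) →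
        ∀ l, |(T.toCertData φ).ℓ ((T.toCertData φ).nx j) l ((T.toCertData φ).land j ((T.toCertData φ).TP j ((T.toCertData φ).S j - 1) u + w') v) -
              (T.toCertData φ).ctr ((T.toCertData φ).nx j) l| + (T.toCertData φ).β j l ≤
          (T.toCertData φ).rad ((T.toCertData φ).nx j) l - (T.toCertData φ).s ((T.toCertData φ).nx j) l := by
  simp only [checkRO_land, allN_eq_true, Bool.and_eq_true, decide_eq_true_eq] at h
  obtain ⟨⟨ha, hLv⟩, hfaces⟩ := h
  intro u hu w' hw _ v hv l
  change u ∈ Set.Icc 0 (φ (T.step j ((T.stage j).S - 1)).h) at hu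
  change (T.toCertData φ).InBall j w' (φ (T.step j ((T.stage j).S - 1)).SpI) at hw
  change ∀ i, |v i| ≤ Real.sqrt (10 * φ T.Cg * (2:ℝ) ^ (-(7:ℝ) * ((T.Ka:ℝ) + 1))) at hv
  set s := (T.stage j).S - 1 with hsdef
  set y := (T.toCertData φ).TP j s u + w' with hy
  set G' := T.stage (T.stage j).nx with hG'
  show |T.covR φ (G'.ell.getD l []) ((T.toCertData φ).land j y v) - φ (vget G'.ctr l)| + φ (vget (T.stage j).β l) ≤
    φ (vget G'.rad l) - φ (vget G'.s l)
  -- decomposition ℓ(land) − ctr = Σ ell_c (land_c − mid_c) + (Σ ell_c mid_c − ctr)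
  have hsplit : T.covR φ (G'.ell.getD l []) ((T.toCertData φ).land j y v) =
      ∑ c ∈ Finset.range T.n, φ (vget (G'.ell.getD l []) c) *
        (T.wv ((T.toCertData φ).land j y v) c - φ (T.landMid A j (T.node j s) (T.step j s).h (T.step j s).SpI G'.Lv c)) +
      ∑ c ∈ Finset.range T.n, φ (vget (G'.ell.getD l []) c) *
        φ (T.landMid A j (T.node j s) (T.step j s).h (T.step j s).SpI G'.Lv c) := by
    rw [T.covR_apply φ, ← Finset.sum_add_distrib]
    refine Finset.sum_congr rfl fun c _ => by ring
  have hdev : |∑ c ∈ Finset.range T.n, φ (vget (G'.ell.getD l []) c) *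
        (T.wv ((T.toCertData φ).land j y v) c - φ (T.landMid A j (T.node j s) (T.step j s).h (T.step j s).SpI G'.Lv c))| ≤
      ∑ c ∈ Finset.range T.n, |φ (vget (G'.ell.getD l []) c)| *
        φ (T.landRadius A j (T.node j s) (T.step j s).h (T.step j s).SpI G'.Lv c) := by
    refine (Finset.abs_sum_le_sum_abs _ _).trans (Finset.sum_le_sum fun c hc => ?_)
    rw [Finset.mem_range] at hc
    rw [abs_mul]
    exact mul_le_mul_of_nonneg_left
      (T.abs_wv_land_sub_mid_le hφ A haux j s _ _ hu hw ha hLv v hv hc) (abs_nonneg _)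
  by_cases hl : l < T.nFaces j
  · have hchk := hφ (hfaces l hl)
    rw [map_sub, map_add, map_add, phi_abs hφ, map_sub, phi_sumN, phi_sumN] at hchk
    have e1 : ∑ c ∈ Finset.range T.n, φ (vget (G'.ell.getD l []) c *
        T.landMid A j (T.node j s) (T.step j s).h (T.step j s).SpI G'.Lv c) =
        ∑ c ∈ Finset.range T.n, φ (vget (G'.ell.getD l []) c) *
          φ (T.landMid A j (T.node j s) (T.step j s).h (T.step j s).SpI G'.Lv c) :=
      Finset.sum_congr rfl fun c _ => by rw [map_mul]
    have e2 : ∑ c ∈ Finset.range T.n, φ (|vget (G'.ell.getD l []) c| *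
        T.landRadius A j (T.node j s) (T.step j s).h (T.step j s).SpI G'.Lv c) =
        ∑ c ∈ Finset.range T.n, |φ (vget (G'.ell.getD l []) c)| *
          φ (T.landRadius A j (T.node j s) (T.step j s).h (T.step j s).SpI G'.Lv c) :=
      Finset.sum_congr rfl fun c _ => by rw [map_mul, phi_abs hφ]
    rw [e1, e2] at hchk
    rw [hsplit]
    have htri : |∑ c ∈ Finset.range T.n, φ (vget (G'.ell.getD l []) c) *
          (T.wv ((T.toCertData φ).land j y v) c - φ (T.landMid A j (T.node j s) (T.step j s).h (T.step j s).SpI G'.Lv c)) +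
        ∑ c ∈ Finset.range T.n, φ (vget (G'.ell.getD l []) c) *
          φ (T.landMid A j (T.node j s) (T.step j s).h (T.step j s).SpI G'.Lv c) - φ (vget G'.ctr l)| ≤
        |∑ c ∈ Finset.range T.n, φ (vget (G'.ell.getD l []) c) *
          (T.wv ((T.toCertData φ).land j y v) c - φ (T.landMid A j (T.node j s) (T.step j s).h (T.step j s).SpI G'.Lv c))| +
        |∑ c ∈ Finset.range T.n, φ (vget (G'.ell.getD l []) c) *
          φ (T.landMid A j (T.node j s) (T.step j s).h (T.step j s).SpI G'.Lv c) - φ (vget G'.ctr l)| := by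
      rw [add_sub_assoc]; exact abs_add_le _ _
    linarith
  · -- beyond every table: all junk zeros
    rw [not_lt] at hl
    unfold nFaces at hl
    simp only [max_le_iff] at hl
    obtain ⟨⟨⟨hl1, hl2⟩, hl3, hl4⟩, hl5⟩ := hl
    have e1 : G'.ell.getD l [] = [] := List.getD_eq_default _ _ hl1
    rw [e1, T.covR_nil φ, vget_of_le _ hl2, vget_of_le _ hl3, vget_of_le _ hl4, vget_of_le _ hl5]
    simp

end Landing

end CertTables

end Summit.NavierStokesRegularity.NavierStokesRegularity.Theorems.TaylorModelCert
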